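import Mathlib
import Literature.NumberTheory.LFunctions.MertensElementary
import HarnessLib

/-!
# Toolkit: the Euler-product weight `∏_{q∣n}(1 + c·q^{−σ})` is uniformly polylogarithmic for
# `σ ≥ 1 − 1/(16L)` and `log n ≤ 3L⁹`

Topic `Literature/NumberTheory/LFunctions/Zhang2022` (ZHANG-L discharge lane; theorems only, no definitions).
In the contour steps of Y. Zhang, *Discrete mean estimates and the Landau–Siegel zero*, arXiv:2211.02515v1
(2022) [Zhang2022LandauSiegel] §15 (15.9)–(15.15), §16 u015/(16.10), §7 (7.19)–(7.20), the integrands carry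
finite Euler products over the prime factors of the summation variables (`κ̃ⱼ(d₁;r,s)`, `λⱼ(n,s)`,
`ℳⱼ(d,l;s)`), whose local factors are `1 + O(q^{−σ})`. On Landau's broken line `σ ≥ 1 − c/𝓛` (`𝓛 = log D`)
such a product is NOT controlled by the crude `q^{−σ} ≤ q^{−9/10}` (that gives `exp(≍𝓛^{0.9})` for
primorial-type `n < e^{3𝓛⁹}`), but it IS uniformly polylogarithmic by splitting the primes at `e^{16L}`:
for `q ≤ e^{16L}` one has `q^{1−σ} ≤ q^{1/(16L)} ≤ e`, so `q^{−σ} ≤ e/q` and Mertens' bound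
`Σ_{p≤X} 1/p ≤ log log X + 4` (the tree's `MertensBound.sum_inv_prime_le` [cite: HardyWright2008, Thm 427])
applies; for `q > e^{16L}`, `q^{−σ} ≤ q^{−15/16} ≤ e^{−15L}` and there are at most `ω(n) ≤ 2 log n ≤ 6L⁹` such
primes. (This is the referee's remark zl-w16-ref-1 2026-08-27T00:38Z on the u015/(16.10) instances.)

* `card_primeFactors_le_log` — `ω(n)·log 2 ≤ log n`;
* `rpow_neg_le_exp_one_div` — `q^{−σ} ≤ e/q` for `1 ≤ q ≤ e^{16L}`, `σ ≥ 1 − 1/(16L)`;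
* `sum_primeFactors_rpow_neg_le` — `Σ_{q∣n} q^{−σ} ≤ e(log(16L) + 4) + 1`;
* `prod_primeFactors_one_add_mul_rpow_neg_le` — `∏_{q∣n}(1 + c·q^{−σ}) ≤ exp(c(e(log(16L)+4)+1))` (`c ≥ 0`).

No definitions, no named facts, no `sorry`. Nothing here is a claim of the manuscript.

## References

* G. H. Hardy, E. M. Wright, *An Introduction to the Theory of Numbers*, 6th ed., OUP 2008, Thm 427 (Mertens).
  [cite: HardyWright2008, Thm 427]
* Y. Zhang, arXiv:2211.02515v1 (2022), §16 p. 90 (u015), p. 92 (16.10); §15 (15.15) p. 85 — where the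
  weight is consumed. [cite: Zhang2022LandauSiegel, §16 p.90]
-/

noncomputable section

open Real Finset

namespace Literature.NumberTheory.LFunctions.Zhang2022.EulerWeightPolylog

/-- **`ω(n) log 2 ≤ log n`** (`n ≥ 1`): `2^{ω(n)} ≤ ∏_{q∣n} q ≤ n`. [folklore] -/
private theorem card_primeFactors_mul_log_two_le {n : ℕ} (hn : n ≠ 0) :
    (n.primeFactors.card : ℝ) * Real.log 2 ≤ Real.log n := by
  have h1 : 2 ^ n.primeFactors.card ≤ ∏ q ∈ n.primeFactors, q :=
    Finset.pow_card_le_prod _ _ _ fun q hq => (Nat.prime_of_mem_primeFactors hq).two_le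
  have h2 : ∏ q ∈ n.primeFactors, q ∣ n := Nat.prod_primeFactors_dvd n
  have h3 : ∏ q ∈ n.primeFactors, q ≤ n := Nat.le_of_dvd (Nat.pos_of_ne_zero hn) h2
  have h4 : ((2 : ℕ) : ℝ) ^ n.primeFactors.card ≤ (n : ℝ) := by exact_mod_cast h1.trans h3
  have h5 : Real.log ((2 : ℝ) ^ n.primeFactors.card) ≤ Real.log n :=
    Real.log_le_log (by positivity) (by exact_mod_cast h1.trans h3)
  rwa [Real.log_pow] at h5

/-- **`q^{−σ} ≤ e/q`** for `1 ≤ q ≤ e^{16L}` (`L > 0`) and `σ ≥ 1 − 1/(16L)`: `q^{−σ} = q^{−1}q^{1−σ}` and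
`q^{1−σ} ≤ q^{1/(16L)} ≤ (e^{16L})^{1/(16L)} = e`. [cite: Zhang2022LandauSiegel, §16 p.90] -/
theorem rpow_neg_le_exp_one_div {L σ q : ℝ} (hL : 0 < L) (hσ : 1 - 1 / (16 * L) ≤ σ) (hq1 : 1 ≤ q)
    (hqX : q ≤ Real.exp (16 * L)) : q ^ (-σ) ≤ Real.exp 1 / q := by
  have hq0 : 0 < q := by linarith
  have h1 : q ^ (-σ) = q ^ (1 - σ) * q⁻¹ := by
    rw [show (-σ) = (1 - σ) + (-1) by ring, Real.rpow_add hq0, Real.rpow_neg_one]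
  have h2 : q ^ (1 - σ) ≤ q ^ (1 / (16 * L)) :=
    Real.rpow_le_rpow_of_exponent_le hq1 (by linarith)
  have h3 : q ^ (1 / (16 * L)) ≤ Real.exp (16 * L) ^ (1 / (16 * L)) :=
    Real.rpow_le_rpow hq0.le hqX (by positivity)
  have h4 : Real.exp (16 * L) ^ (1 / (16 * L)) = Real.exp 1 := by
    rw [← Real.exp_mul]; congr 1; field_simp
  rw [h1, div_eq_mul_inv]
  exact mul_le_mul_of_nonneg_right (h2.trans (h3.trans h4.le)) (inv_nonneg.mpr hq0.le)

/-- **`Σ_{q∣n} q^{−σ} ≤ e(log(16L) + 4) + 1`** for `L ≥ 1`, `σ ≥ 1 − 1/(16L)`, `n ≥ 1` with `log n ≤ 3L⁹`: the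
primes `q ≤ e^{16L}` give `≤ e·Σ_{p≤e^{16L}} 1/p ≤ e(log(16L) + 4)` (Mertens), the primes `q > e^{16L}` give
`≤ ω(n)·e^{−15L} ≤ 6L⁹e^{−15L} ≤ 1`. [cite: Zhang2022LandauSiegel, §16 p.90] -/
theorem sum_primeFactors_rpow_neg_le {L σ : ℝ} (hL : 1 ≤ L) (hσ : 1 - 1 / (16 * L) ≤ σ) {n : ℕ} (hn : n ≠ 0)
    (hlogn : Real.log n ≤ 3 * L ^ 9) :
    ∑ q ∈ n.primeFactors, (q : ℝ) ^ (-σ) ≤ Real.exp 1 * (Real.log (16 * L) + 4) + 1 := by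
  classical
  have hL0 : 0 < L := by linarith
  set X : ℕ := ⌊Real.exp (16 * L)⌋₊ with hX
  have hX16 : (2 : ℝ) ≤ Real.exp (16 * L) := by
    have := Real.add_one_le_exp (16 * L); linarith
  have hX2 : 2 ≤ X := Nat.le_floor (by exact_mod_cast hX16)
  have hXle : (X : ℝ) ≤ Real.exp (16 * L) := Nat.floor_le (Real.exp_pos _).le
  have hXpos : (0 : ℝ) < X := by exact_mod_cast (show 0 < X by omega)
  -- split the prime factors at `X`
  rw [← Finset.sum_filter_add_sum_filter_not n.primeFactors (fun q => q ≤ X)]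
  have hsmall : ∑ q ∈ n.primeFactors.filter (fun q => q ≤ X), (q : ℝ) ^ (-σ) ≤
      Real.exp 1 * (Real.log (16 * L) + 4) := by
    have h1 : ∑ q ∈ n.primeFactors.filter (fun q => q ≤ X), (q : ℝ) ^ (-σ) ≤
        ∑ q ∈ n.primeFactors.filter (fun q => q ≤ X), Real.exp 1 * ((1 : ℝ) / q) := by
      refine Finset.sum_le_sum fun q hq => ?_
      obtain ⟨hq, hqX⟩ := Finset.mem_filter.mp hq
      have hq1 : (1 : ℝ) ≤ q := by exact_mod_cast (Nat.prime_of_mem_primeFactors hq).one_le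
      have hqX' : (q : ℝ) ≤ Real.exp (16 * L) := le_trans (by exact_mod_cast hqX) hXle
      rw [one_div, ← div_eq_mul_inv]
      exact rpow_neg_le_exp_one_div hL0 hσ hq1 hqX'
    have h2 : ∑ q ∈ n.primeFactors.filter (fun q => q ≤ X), Real.exp 1 * ((1 : ℝ) / q) ≤
        Real.exp 1 * ∑ p ∈ Nat.primesLE X, (1 : ℝ) / p := by
      rw [← Finset.mul_sum]
      refine mul_le_mul_of_nonneg_left ?_ (Real.exp_pos 1).le
      refine Finset.sum_le_sum_of_subset_of_nonneg (fun q hq => ?_) (fun p _ _ => by positivity)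
      obtain ⟨hq, hqX⟩ := Finset.mem_filter.mp hq
      rw [Nat.primesLE_eq_filter_range, Finset.mem_filter, Finset.mem_range]
      exact ⟨by omega, Nat.prime_of_mem_primeFactors hq⟩
    have h3 := Literature.NumberTheory.LFunctions.MertensBound.sum_inv_prime_le X hX2
    have h4 : Real.log (Real.log X) ≤ Real.log (16 * L) := by
      have hlogX : Real.log X ≤ 16 * L := by
        calc Real.log X ≤ Real.log (Real.exp (16 * L)) := Real.log_le_log hXpos hXle
          _ = 16 * L := Real.log_exp _
      have hlogX0 : 0 < Real.log X := Real.log_pos (by exact_mod_cast (show 1 < X by omega))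
      exact Real.log_le_log hlogX0 hlogX
    calc ∑ q ∈ n.primeFactors.filter (fun q => q ≤ X), (q : ℝ) ^ (-σ)
        ≤ Real.exp 1 * ∑ p ∈ Nat.primesLE X, (1 : ℝ) / p := h1.trans h2
      _ ≤ Real.exp 1 * (Real.log (Real.log X) + 4) := mul_le_mul_of_nonneg_left h3 (Real.exp_pos 1).le
      _ ≤ Real.exp 1 * (Real.log (16 * L) + 4) := by gcongr
  have hlarge : ∑ q ∈ n.primeFactors.filter (fun q => ¬ q ≤ X), (q : ℝ) ^ (-σ) ≤ 1 := by
    -- each term `≤ e^{−15L}`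
    have hσ15 : (15 : ℝ) / 16 ≤ σ := by
      have h : 1 / (16 * L) ≤ 1 / 16 := by
        rw [div_le_div_iff₀ (by positivity) (by norm_num)]; linarith
      linarith
    have hterm : ∀ q ∈ n.primeFactors.filter (fun q => ¬ q ≤ X), (q : ℝ) ^ (-σ) ≤ Real.exp (-15 * L) := by
      intro q hq
      obtain ⟨hq, hqX⟩ := Finset.mem_filter.mp hq
      have hqgt : Real.exp (16 * L) < q := by
        have : (X : ℝ) + 1 ≤ q := by exact_mod_cast (show X + 1 ≤ q by omega)
        have := Nat.lt_floor_add_one (Real.exp (16 * L))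
        linarith
      have hq1 : (1 : ℝ) < q := lt_of_le_of_lt (by linarith [hX16]) hqgt
      have hq0 : (0 : ℝ) < q := by linarith
      calc (q : ℝ) ^ (-σ) ≤ (q : ℝ) ^ (-(15 / 16 : ℝ)) :=
            Real.rpow_le_rpow_of_exponent_le hq1.le (by linarith)
        _ ≤ Real.exp (16 * L) ^ (-(15 / 16 : ℝ)) := by
            rw [Real.rpow_neg hq0.le, Real.rpow_neg (Real.exp_pos _).le]
            exact inv_anti₀ (Real.rpow_pos_of_pos (Real.exp_pos _) _)
              (Real.rpow_le_rpow (Real.exp_pos _).le hqgt.le (by norm_num))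
        _ = Real.exp (-15 * L) := by
            rw [← Real.exp_mul]; congr 1; ring
    -- the number of terms is `≤ ω(n) ≤ 6L⁹`
    have hcard : ((n.primeFactors.filter (fun q => ¬ q ≤ X)).card : ℝ) ≤ 6 * L ^ 9 := by
      have h1 : ((n.primeFactors.filter (fun q => ¬ q ≤ X)).card : ℝ) ≤ n.primeFactors.card := by
        exact_mod_cast Finset.card_le_card (Finset.filter_subset _ _)
      have h2 := card_primeFactors_mul_log_two_le hn
      have hlog2 : (1 : ℝ) / 2 < Real.log 2 := by linarith [Real.log_two_gt_d9]
      have h3 : (n.primeFactors.card : ℝ) * (1 / 2) ≤ 3 * L ^ 9 := by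
        have h0 : (0 : ℝ) ≤ n.primeFactors.card := Nat.cast_nonneg _
        nlinarith
      linarith
    -- `6L⁹·e^{−15L} ≤ 1`: `(15L)⁹/9! ≤ e^{15L}`
    have hexp : 6 * L ^ 9 * Real.exp (-15 * L) ≤ 1 := by
      have hf := Real.pow_div_factorial_le_exp (15 * L) (by positivity) 9
      have h9 : ((Nat.factorial 9 : ℕ) : ℝ) = 362880 := by norm_num [Nat.factorial]
      rw [h9] at hf
      rw [show (-15 * L) = -(15 * L) by ring, Real.exp_neg]
      have hpos : 0 < Real.exp (15 * L) := Real.exp_pos _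
      rw [← div_eq_mul_inv, div_le_one hpos]
      have : (15 * L) ^ 9 / 362880 = 15 ^ 9 / 362880 * L ^ 9 := by ring
      rw [this] at hf
      nlinarith [pow_nonneg hL0.le 9]
    calc ∑ q ∈ n.primeFactors.filter (fun q => ¬ q ≤ X), (q : ℝ) ^ (-σ)
        ≤ ∑ q ∈ n.primeFactors.filter (fun q => ¬ q ≤ X), Real.exp (-15 * L) := Finset.sum_le_sum hterm
      _ = ((n.primeFactors.filter (fun q => ¬ q ≤ X)).card : ℝ) * Real.exp (-15 * L) := by
          rw [Finset.sum_const, nsmul_eq_mul]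
      _ ≤ 6 * L ^ 9 * Real.exp (-15 * L) :=
          mul_le_mul_of_nonneg_right hcard (Real.exp_pos _).le
      _ ≤ 1 := hexp
  exact add_le_add hsmall hlarge

/-- **`∏_{q∣n}(1 + c·q^{−σ}) ≤ exp(c(e(log(16L)+4)+1))`** for `c ≥ 0`, `L ≥ 1`, `σ ≥ 1 − 1/(16L)`, `n ≥ 1` with
`log n ≤ 3L⁹` (`1 + x ≤ eˣ` and `sum_primeFactors_rpow_neg_le`) — uniformly polylogarithmic in `e^L`.
[cite: Zhang2022LandauSiegel, §16 p.90] -/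
theorem prod_primeFactors_one_add_mul_rpow_neg_le {L σ c : ℝ} (hL : 1 ≤ L) (hσ : 1 - 1 / (16 * L) ≤ σ)
    (hc : 0 ≤ c) {n : ℕ} (hn : n ≠ 0) (hlogn : Real.log n ≤ 3 * L ^ 9) :
    ∏ q ∈ n.primeFactors, (1 + c * (q : ℝ) ^ (-σ)) ≤
      Real.exp (c * (Real.exp 1 * (Real.log (16 * L) + 4) + 1)) := by
  have hS := sum_primeFactors_rpow_neg_le hL hσ hn hlogn
  have h1 : ∏ q ∈ n.primeFactors, (1 + c * (q : ℝ) ^ (-σ)) ≤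
      ∏ q ∈ n.primeFactors, Real.exp (c * (q : ℝ) ^ (-σ)) := by
    refine Finset.prod_le_prod (fun q _ => by positivity) fun q _ => ?_
    have := Real.add_one_le_exp (c * (q : ℝ) ^ (-σ))
    linarith
  rw [← Real.exp_sum, ← Finset.mul_sum] at h1
  exact h1.trans (Real.exp_le_exp.mpr (mul_le_mul_of_nonneg_left hS hc))

/-- The same product bound in the frequently used form `∏_{q∣n}(1 + c/q^{σ})`.
[cite: Zhang2022LandauSiegel, §16 p.90] -/
theorem prod_primeFactors_one_add_div_rpow_le {L σ c : ℝ} (hL : 1 ≤ L) (hσ : 1 - 1 / (16 * L) ≤ σ)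
    (hc : 0 ≤ c) {n : ℕ} (hn : n ≠ 0) (hlogn : Real.log n ≤ 3 * L ^ 9) :
    ∏ q ∈ n.primeFactors, (1 + c / (q : ℝ) ^ σ) ≤
      Real.exp (c * (Real.exp 1 * (Real.log (16 * L) + 4) + 1)) := by
  have h := prod_primeFactors_one_add_mul_rpow_neg_le hL hσ hc hn hlogn
  refine le_trans (le_of_eq (Finset.prod_congr rfl fun q hq => ?_)) h
  have hq0 : (0 : ℝ) ≤ q := Nat.cast_nonneg _
  rw [Real.rpow_neg hq0, div_eq_mul_inv]

end Literature.NumberTheory.LFunctions.Zhang2022.EulerWeightPolylog
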